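import Summits.ABC.IUTFork.Thm311RealDegreeArch
import Summits.ABC.IUTFork.Thm311RealArchHermitian
import Literature.IUT.LogVolume.PrincipalArithmeticDivisors
import HarnessLib

/-!
# [IUTchIII] Prop. 3.9 (iii) made GLOBAL at the real carriers: the PRODUCT FORMULA for the probability-weighted
# container at the primes (abc-iut-c312-1) together with the honest archimedean container (abc-iut-w5-d163) —
# the principal region of `a ∈ F^×` has total log-volume ZERO

Record file (D-0012) of the abc-iut cell (WAVE-4 D-0067 cone-interior discharge prover, seat abc-iut-w4-d001, gen 2;
home layer L6); TAKES NO SIDE on [IUTchIII] Cor. 3.12. A GLOBAL UNIT TEST of the cell's repaired mono-analytic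
container of [IUTchIII] Rmk. 3.1.1 (ii)(iii) on the real log-shells `Real.logShellsDH` — at `v_ℚ = p` abc-iut-c312-1's
PROBABILITY-WEIGHTED real prime packets (`Real.summandPiecesPr`, `Thm311RealDegree`, the repair of finding
F-c312-1-g5-1: weights `Pr(v⃗) = Π n_{v_a}/[F:ℚ]^{j+1}` against the normalised `log μ̄`), at `v_ℚ = ∞` abc-iut-w5-d163's
HONEST archimedean pieces (`Cor312VolumesArchSummands`: the real packet `M_I = ⊗_ℝ ⊕_{w|∞} ℂ_w` of [IUTchIV] Prop. 1.5
(iii) with abc-iut-L5-t7's normalised packet log-volume `packetLogVol Φ₀`, weight `1`). The two local normalisations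
are certified locally in the tree (`logvol_p_mul_Pr`: `×p ↦ −log p`; `logμ_pi_pow_smul_ball`/`packetLogVol_ball`: `B_I ↦ 0`,
`×e ↦ +1`). THIS FILE certifies that they are MUTUALLY CONSISTENT in the only global sense print offers —
[IUTchIII] Prop. 3.9 (iii), kurims `paper:url-4b091feeb646` p. 117: the global log-volume "is equal to the degree of
the arithmetic line bundle determined by `𝔍`", and arithmetic degrees kill principal divisors (product formula):

* `Real.archPrincipalElt j a` — the element `ι_j(a) = 1 ⊗ ⋯ ⊗ (σ_w(a))_{w|∞} ⊗ ⋯ ⊗ 1` of the real archimedean packet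
  (the number `a ∈ F` acting through the tensor factor labelled `j` = abc-iut-c312-1's `selfIndex j`, as in its
  `idealBox`); `Real.archPrincipalRegion j a := ι_j(a)·B_I` — the archimedean component of the region of the
  principal (Arakelov) divisor of `a`;
* `Real.logμ_archPrincipalRegion` — its normalised log-volume is the AVERAGE over `w | ∞` of `log |σ_w(a)|`
  (`Φ₀(ι_j(a)·B_I)` is the polydisc of radii `|σ_{w⃗(j)}(a)|`, L5-t7 `nlogVol_polydisc`; uniform marginal over the
  index set `𝕍_∞^{S^±_{j+1}} × {±}^{S^±_{j+1}∖{i₀}}`), `= (1/[F:ℚ])·Σ_{w|∞} [F_w:ℝ]·log|a|_w` when every archimedean place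
  is complex ([IUTchI] Def. 3.1 (a) "`√−1 ∈ F`"; `Real.logμ_archPrincipalRegion_eq_of_isComplex`);
* the finite components := abc-iut-c312-1's ideal regions `idealRegion … (−div a)` of the divisor `−div(a)` (boxes
  `ι_j(ϖ_v^{ord_v(a)})·(R_{v⃗})^∼`, i.e. `a·𝒪` in the factor `j` up to a unit), whose Pr-weighted log-volumes sum to
  `−(1/[F:ℚ])·Σ_v ord_v(a)·log|κ(v)|` (c312-1 `finsum_logvol_idealRegion`);
* **`Real.finsum_logvol_principal_add_arch_eq_zero`** — THE PRODUCT FORMULA IN THE CONTAINER'S UNITS: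
  `Σ_{v_ℚ} (summandPiecesPr).logvol(idealRegion(−div a) at v_ℚ) + μ^log_∞(ι_j(a)·B_I) = 0` for every `a ∈ F^×` and every
  label `j` — here the first sum runs over ALL `v_ℚ` in abc-iut-c312-1's container `summandPiecesPr` (trivial at `∞`:
  its `∞`-term is `0`, `logvol_idealRegion_inl`) and the archimedean term is w5-d163's log-measure
  `ArchPresentation.logμ (infty X) j` of the region `ι_j(a)·B_I` of `M_I` (Mathlib `NumberField.prod_abs_eq_one` through
  the tree's `sum_mult_log_add_sum_log_adicAbv_eq_zero`);
* **`Real.finsum_logvol_merged_principal_eq_zero`** — the same identity INSIDE the merged container of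
  abc-iut-c312-1's `Thm311RealDegreeArch` (p421027), `summandPiecesPrWith X (archPresentationDH X logv hc).toLocalPieces hlog`
  (Pr at `p` ⊕ w5-d163's pieces at `∞`): with the region `idealRegionWith` whose archimedean component is the pull-back
  `e⁻¹(ι_j(a)·B_I)` along w5-d163's comparison, `Σᶠ_{v_ℚ} logvol = 0` (`logvol_merged_archPrincipalRegion`: the `∞`-term is
  `1·μ^log_∞(ι_j(a)·B_I)` by `SummandPieces.logvol_eq_of_pi`, exactly as c312-1's `logvol_archUnitRegion`; the prime terms
  are those of `summandPiecesPr`, `logvol_merged_idealRegionWith_of_ne`).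
This is the global companion of c312-1's `finsum_logvol_idealRegionWith` (ideal regions with an archimedean component
of log-volume `0` ↦ normalised degree): principal ARAKELOV divisors, archimedean component included, get global
log-volume `0`. For comparison (not formalised here): with c312-5's original constant weight `1/[F:ℚ]^{j+1}` at `p`,
or with the trivial container at `∞`, the corresponding left-hand side is `(1/[F:ℚ])·Σ_p ((#𝕍(F)_p/[F:ℚ])^{j+1} − 1)·Σ_{v|p} …`
resp. `−(1/[F:ℚ])·log|N(a)|`, nonzero in general. [claim: Mochizuki2012, status: disputed] for the quoted container;
classical number-field arithmetic (product formula) and Lebesgue measure otherwise. typed ≠ proved; instantiated ≠ endorsed.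
Deliberately NOT here: Θ-boxes, hulls, any judgement.
-/

noncomputable section

open Set Function NumberField IsDedekindDomain MeasureTheory PiTensorProduct
open scoped Pointwise

namespace Summit.ABC.IUTFork.Thm311.Real

open Cor312Vol Cor312Vol.ArchPresentation Literature.IUT.LogVolume Literature.IUT.LogVolume.Prop15iii
  Literature.IUT.LogVolume.ArchPacket Literature.IUT.LogThetaLattice

attribute [local instance] Cor312Vol.ArchPresentation.fibreFintype

variable {F : Type} [Field F] [NumberField F] (X : PilotData F)

/-! ## 1. The element `ι_j(a)` of the real archimedean packet and the principal region `ι_j(a)·B_I` -/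

variable (j : (thetaIndex X).Label) (a : F)

/-- The factor family of `ι_j(a)`: `(σ_w(a))_{w|∞}` in the factor `selfIndex j`, the unit `1` elsewhere. [folklore] -/
def archPrincipalFactors : (thetaIndex X).Caps j → M (ArchFibre X) :=
  Function.update (fun _ => 1) ((thetaIndex X).selfIndex j) fun w => (fibreEquivInfinitePlace X w).embedding a

/-- **`ι_j(a) ∈ M_{S^±_{j+1}} = ⊗_ℝ ⊕_{w|∞} ℂ_w`**: the number `a ∈ F` read in every `ℂ_w` (`σ_w(a)`) and placed in the
tensor factor labelled `j` ([IUTchIII] Prop. 3.3 (i)/3.4 (ii): the number field acts on `𝓘^ℚ(^{S^±_{j+1},j};−)` through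
the factor `j`; abc-iut-c312-1's `idealBox` convention `selfIndex j`). [claim: Mochizuki2012, status: disputed] -/
def archPrincipalElt : ArchPresentation.X (T := thetaIndex X) (infty X) j :=
  tprod ℝ (archPrincipalFactors X j a)

/-- **The archimedean component of the principal region of `a`: `ι_j(a)·B_I`** (`B_I` = L5-t7's `ball Φ₀`, the
product of the unit discs of the copies of `ℂ`, [IUTchIV] Prop. 1.5 (iii); [IUTchIII] Prop. 3.9 (i): log-volume `0`).
[claim: Mochizuki2012, status: disputed] -/
def archPrincipalRegion : Set (ArchPresentation.X (T := thetaIndex X) (infty X) j) :=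
  archPrincipalElt X j a • ball (Φ₀ (T := thetaIndex X) (infty X) j)

/-- The coordinates of `ι_j(a)`: `Φ₀(ι_j(a))_{(w⃗,ε)} = cj_{ε(j)}(σ_{w⃗(j)}(a))`. [folklore] -/
theorem Φ₀_archPrincipalElt (idx : ArchPresentation.J (T := thetaIndex X) (infty X) j) :
    Φ₀ (T := thetaIndex X) (infty X) j (archPrincipalElt X j a) idx =
      cj (extend ((thetaIndex X).Caps j) idx.2 ((thetaIndex X).selfIndex j))
        ((fibreEquivInfinitePlace X (idx.1 ((thetaIndex X).selfIndex j))).embedding a) := by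
  rw [archPrincipalElt, Φ₀, canonicalDecomposition_tprod]
  rw [Finset.prod_eq_single ((thetaIndex X).selfIndex j)]
  · rw [archPrincipalFactors, Function.update_self]
  · intro i _ hi
    rw [archPrincipalFactors, Function.update_of_ne hi]
    exact map_one _
  · intro h
    exact absurd (Finset.mem_univ _) h

/-- `|Φ₀(ι_j(a))_{(w⃗,ε)}| = |a|_{w⃗(j)}`. [folklore] -/
theorem norm_Φ₀_archPrincipalElt (idx : ArchPresentation.J (T := thetaIndex X) (infty X) j) :
    ‖Φ₀ (T := thetaIndex X) (infty X) j (archPrincipalElt X j a) idx‖ =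
      (fibreEquivInfinitePlace X (idx.1 ((thetaIndex X).selfIndex j))) a := by
  rw [Φ₀_archPrincipalElt, norm_cj, InfinitePlace.norm_embedding_eq]

variable {a}

/-- **`Φ₀(ι_j(a)·B_I)` is the polydisc of radii `|a|_{w⃗(j)}`** (`Φ₀` is an `ℝ`-algebra isomorphism carrying `B_I` onto
the unit polydisc, L5-t7 `image_ball`). [folklore] -/
theorem coords_archPrincipalRegion (ha : a ≠ 0) :
    coords (T := thetaIndex X) (infty X) j (archPrincipalRegion X j a) =
      polydisc (ArchPresentation.J (T := thetaIndex X) (infty X) j)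
        fun idx : ArchPresentation.J (T := thetaIndex X) (infty X) j =>
          (fibreEquivInfinitePlace X (idx.1 ((thetaIndex X).selfIndex j))) a := by
  have hpos : ∀ idx : ArchPresentation.J (T := thetaIndex X) (infty X) j,
      0 < (fibreEquivInfinitePlace X (idx.1 ((thetaIndex X).selfIndex j))) a := fun idx =>
    (InfinitePlace.pos_iff).mpr ha
  set u := archPrincipalElt X j a with hu
  set Φ := Φ₀ (T := thetaIndex X) (infty X) j with hΦ
  ext y
  simp only [coords, archPrincipalRegion, ArchPacket.polydisc, Set.mem_image, Set.mem_smul_set, Set.mem_setOf_eq]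
  constructor
  · rintro ⟨x, ⟨b, hb, rfl⟩, rfl⟩ idx
    rw [← hΦ, smul_eq_mul, map_mul, Pi.mul_apply, norm_mul, ← hu, norm_Φ₀_archPrincipalElt]
    exact mul_le_of_le_one_right (hpos idx).le (hb idx)
  · intro hy
    have hne : ∀ idx, Φ u idx ≠ 0 := fun idx => by
      rw [← norm_pos_iff, hΦ, hu, norm_Φ₀_archPrincipalElt]; exact hpos idx
    refine ⟨u * Φ.symm (fun idx => y idx / Φ u idx), ⟨Φ.symm (fun idx => y idx / Φ u idx), fun idx => ?_, rfl⟩,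
      ?_⟩
    · rw [← hΦ, AlgEquiv.apply_symm_apply, norm_div, div_le_one (norm_pos_iff.mpr (hne idx)), hΦ, hu,
        norm_Φ₀_archPrincipalElt]
      exact hy idx
    · funext idx
      rw [← hΦ, map_mul, AlgEquiv.apply_symm_apply, Pi.mul_apply, mul_div_cancel₀ _ (hne idx)]

/-! ## 2. Its log-volume: the average of `log |a|_w` over the archimedean places -/

/-- Uniform marginal over one coordinate of a tuple: `Σ_{w⃗ : I → V} f(w⃗(i₀)) = |V|^{|I|−1}·Σ_w f(w)`, in the form
`Σ_{w⃗} f(w⃗ i₀) · |V| = |I → V| · Σ_w f w`. [folklore] -/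
theorem sum_pi_eval_mul_card {I V : Type} [Fintype I] [DecidableEq I] [Fintype V] (i₀ : I) (f : V → ℝ) :
    (∑ g : I → V, f (g i₀)) * Fintype.card V = Fintype.card (I → V) * ∑ w, f w := by
  classical
  let e := Equiv.piSplitAt i₀ (fun _ : I => V)
  have h1 : ∑ g : I → V, f (g i₀) = ∑ q : V × ({i // i ≠ i₀} → V), f q.1 := by
    refine Fintype.sum_equiv e _ _ fun g => ?_
    rfl
  have h2 : Fintype.card (I → V) = Fintype.card V * Fintype.card ({i // i ≠ i₀} → V) := by
    rw [Fintype.card_congr e, Fintype.card_prod]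
  rw [h1, Fintype.sum_prod_type, h2]
  simp only [Finset.sum_const, Finset.card_univ, nsmul_eq_mul]
  push_cast
  rw [← Finset.mul_sum]
  ring

/-- **`μ^log_∞(ι_j(a)·B_I) = (1/#𝕍(F)_∞)·Σ_{w|∞} log|σ_w(a)|`** — the normalised log-volume of L5-t7/w5-d163 (average of the
radial log-volumes of the `|𝕍_∞|^{j+1}·2^j` copies of `ℂ`; [IUTchIII] Prop. 3.9 (i), archimedean case) of the principal
region is the uniform average of `log|a|_w` over the archimedean places. [claim: Mochizuki2012, status: disputed] -/
theorem logμ_archPrincipalRegion (ha : a ≠ 0) :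
    ArchPresentation.logμ (T := thetaIndex X) (infty X) j (archPrincipalRegion X j a) =
      (Fintype.card (ArchFibre X) : ℝ)⁻¹ * ∑ w : ArchFibre X, Real.log ((fibreEquivInfinitePlace X w) a) := by
  have hpos : ∀ idx : ArchPresentation.J (T := thetaIndex X) (infty X) j,
      0 < (fibreEquivInfinitePlace X (idx.1 ((thetaIndex X).selfIndex j))) a := fun idx =>
    (InfinitePlace.pos_iff).mpr ha
  have h1 : ArchPresentation.logμ (T := thetaIndex X) (infty X) j (archPrincipalRegion X j a) =
      nlogVol (ArchPresentation.J (T := thetaIndex X) (infty X) j)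
        (coords (T := thetaIndex X) (infty X) j (archPrincipalRegion X j a)) := rfl
  rw [h1, coords_archPrincipalRegion X j ha, nlogVol_polydisc _ hpos]
  -- uniform marginal over the coordinate `selfIndex j` of `w⃗`, the sign component being irrelevant
  have hV : (0 : ℝ) < Fintype.card (ArchFibre X) := by exact_mod_cast Fintype.card_pos
  have hIV : (0 : ℝ) < Fintype.card ((thetaIndex X).Caps j → ArchFibre X) := by exact_mod_cast Fintype.card_pos
  have hS : (0 : ℝ) <
      Fintype.card ({i : (thetaIndex X).Caps j // i ≠ basePoint ((thetaIndex X).Caps j)} → Bool) := by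
    exact_mod_cast Fintype.card_pos
  have key := sum_pi_eval_mul_card ((thetaIndex X).selfIndex j) fun w : ArchFibre X => Real.log ((fibreEquivInfinitePlace X w) a)
  have key' : ∑ g : (thetaIndex X).Caps j → ArchFibre X, Real.log ((fibreEquivInfinitePlace X (g ((thetaIndex X).selfIndex j))) a) =
      Fintype.card ((thetaIndex X).Caps j → ArchFibre X) * (∑ w : ArchFibre X, Real.log ((fibreEquivInfinitePlace X w) a)) /
        Fintype.card (ArchFibre X) := by
    rw [eq_div_iff hV.ne']
    exact key
  rw [Fintype.card_prod, Fintype.sum_prod_type]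
  simp only [Finset.sum_const, Finset.card_univ, nsmul_eq_mul]
  rw [← Finset.mul_sum, key']
  push_cast
  field_simp

open scoped Classical in
/-- With every archimedean place COMPLEX ([IUTchI] Def. 3.1 (a) "`√−1 ∈ F`": `#𝕍_∞ = r₂`, `[F:ℚ] = 2r₂`, `[F_w:ℝ] = 2`) the
archimedean log-volume of the principal region is `(1/[F:ℚ])·Σ_{w|∞} [F_w:ℝ]·log|a|_w`. [folklore] -/
theorem logμ_archPrincipalRegion_eq_of_isComplex (hc : ∀ w : InfinitePlace F, w.IsComplex) (ha : a ≠ 0) :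
    ArchPresentation.logμ (T := thetaIndex X) (infty X) j (archPrincipalRegion X j a) =
      (Module.finrank ℚ F : ℝ)⁻¹ * ∑ w : InfinitePlace F, (w.mult : ℝ) * Real.log (w a) := by
  rw [logμ_archPrincipalRegion X j ha]
  have hsum : ∑ w : ArchFibre X, Real.log ((fibreEquivInfinitePlace X w) a) = ∑ w : InfinitePlace F, Real.log (w a) :=
    Fintype.sum_equiv (fibreEquivInfinitePlace X) _ _ fun _ => rfl
  have hcard : Fintype.card (ArchFibre X) = Fintype.card (InfinitePlace F) := Fintype.card_congr (fibreEquivInfinitePlace X)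
  have hmult : ∀ w : InfinitePlace F, (w.mult : ℝ) = 2 := fun w => by
    rw [InfinitePlace.mult, if_neg (InfinitePlace.not_isReal_iff_isComplex.mpr (hc w))]; norm_num
  have hrank : (Module.finrank ℚ F : ℝ) = 2 * Fintype.card (InfinitePlace F) := by
    have h := InfinitePlace.card_add_two_mul_card_eq_rank F
    haveI : IsEmpty {w : InfinitePlace F // w.IsReal} :=
      ⟨fun w => InfinitePlace.not_isReal_iff_isComplex.mpr (hc w.1) w.2⟩
    have h0 : InfinitePlace.nrRealPlaces F = 0 := Fintype.card_eq_zero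
    have hC : InfinitePlace.nrComplexPlaces F = Fintype.card (InfinitePlace F) := by
      unfold InfinitePlace.nrComplexPlaces
      convert Fintype.card_congr (Equiv.subtypeUnivEquiv hc)
    rw [h0, hC, zero_add] at h
    exact_mod_cast h.symm
  have hcard_pos : (0 : ℝ) < Fintype.card (InfinitePlace F) := by exact_mod_cast Fintype.card_pos
  rw [hsum, hcard, hrank]
  simp_rw [hmult]
  rw [← Finset.mul_sum]
  field_simp

/-! ## 3. The product formula in the container's units -/

/-- The integer divisor `−div(a) = Σ_v (−ord_v a)·[v]` of `a ∈ F` (finite support: the tree's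
`finite_setOf_ord_ne_zero`); abc-iut-c312-1's `idealRegion … (negDiv a)` at a prime is then the direct product region
of the boxes `ι_j(ϖ_v^{ord_v(a)})·(R_{v⃗})^∼ = a·𝒪` (through the factor labelled `j`, up to a unit of `𝒪_v`).
[cite: DupuyHilado2025, §2.5.4] -/
def negDiv (a : F) : HeightOneSpectrum (𝓞 F) →₀ ℤ :=
  Finsupp.ofSupportFinite (fun v => -ord F v a)
    ((finite_setOf_ord_ne_zero (F := F) a).subset fun v hv => by
      rw [Function.mem_support, neg_ne_zero] at hv
      exact hv)

/-- `(−div a)(v) = −ord_v(a)`. [folklore] -/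
@[simp] theorem negDiv_apply (a : F) (v : HeightOneSpectrum (𝓞 F)) : negDiv a v = -ord F v a := rfl

variable {logv : PadicLogs F} (hlog : LogvAnalytic logv)

/-- **THE PRODUCT FORMULA IN THE CONTAINER'S UNITS** ([IUTchIII] Prop. 3.9 (iii) made global; Mathlib
`NumberField.prod_abs_eq_one`): for `a ∈ F^×` (all archimedean places complex, [IUTchI] Def. 3.1 (a)) and every label
`j`, the Pr-weighted log-volumes of the ideal regions of `−div(a)` in abc-iut-c312-1's container `summandPiecesPr`, summed
over ALL `v_ℚ` (the `∞`-term of that container is `0`, `logvol_idealRegion_inl`; the prime terms give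
`−(1/[F:ℚ])·Σ_v ord_v(a)·log|κ(v)|`, `finsum_logvol_idealRegion`), plus w5-d163's archimedean log-measure
`ArchPresentation.logμ` of the region `ι_j(a)·B_I` of `M_I` (`= (1/[F:ℚ])·Σ_{w|∞} [F_w:ℝ]·log|a|_w`) vanish. The
merged-container form is `finsum_logvol_merged_principal_eq_zero` below. [claim: Mochizuki2012, status: disputed] -/
theorem finsum_logvol_principal_add_arch_eq_zero (hc : ∀ w : InfinitePlace F, w.IsComplex) (ha : a ≠ 0) :
    (∑ᶠ vQ : (thetaIndex X).VQ,
        (summandPiecesPr X hlog).logvol j vQ (idealRegion X hlog j (negDiv a) vQ)) +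
      ArchPresentation.logμ (T := thetaIndex X) (infty X) j (archPrincipalRegion X j a) = 0 := by
  classical
  rw [finsum_logvol_idealRegion, logμ_archPrincipalRegion_eq_of_isComplex X j hc ha]
  have hT : {v : HeightOneSpectrum (𝓞 F) | ord F v a ≠ 0} ⊆ ((negDiv a).support : Set _) := fun v hv => by
    rw [Finset.mem_coe, Finsupp.mem_support_iff, negDiv_apply]
    exact neg_ne_zero.mpr hv
  have hfin : ((negDiv a).sum fun v c => (c : ℝ) * logNorm F v) =
      ∑ v ∈ (negDiv a).support, Real.log (NumberField.HeightOneSpectrum.adicAbv F v a) := by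
    rw [Finsupp.sum]
    refine Finset.sum_congr rfl fun v _ => ?_
    rw [log_adicAbv_eq_neg_deg F v ha, FinDivisor.deg_of, negDiv_apply]
    push_cast
    ring
  rw [hfin, div_eq_inv_mul, ← mul_add, add_comm,
    sum_mult_log_add_sum_log_adicAbv_eq_zero ha hT, mul_zero]

/-! ## 4. The same identity inside the merged container of `Thm311RealDegreeArch` -/

/-- `ι_j(a)·B_I` is ADMISSIBLE at `∞` for `a ≠ 0` (its coordinates are a polydisc of positive radii: positive finite
volume, L5-t7 `volume_polydisc_pos` / `volume_polydisc_lt_top`). [folklore] -/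
theorem adm_archPrincipalRegion (ha : a ≠ 0) :
    ArchPresentation.adm (T := thetaIndex X) (infty X) j (archPrincipalRegion X j a) := by
  have hpos : ∀ idx : ArchPresentation.J (T := thetaIndex X) (infty X) j,
      0 < (fibreEquivInfinitePlace X (idx.1 ((thetaIndex X).selfIndex j))) a := fun idx =>
    (InfinitePlace.pos_iff).mpr ha
  unfold ArchPresentation.adm
  rw [coords_archPrincipalRegion X j ha]
  exact ⟨(volume_polydisc_pos _ hpos).ne', (volume_polydisc_lt_top _ _).ne⟩

variable (hc : ∀ w : InfinitePlace F, w.IsComplex)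

/-- **At `∞` the merged container assigns to `e⁻¹(ι_j(a)·B_I)` the log-measure `μ^log_∞(ι_j(a)·B_I)`** (one summand of
weight `1`; `SummandPieces.logvol_eq_of_pi` + w5-d163's `e_image_preimage`, the pattern of abc-iut-c312-1's
`logvol_archUnitRegion`). [claim: Mochizuki2012, status: disputed] -/
theorem logvol_merged_archPrincipalRegion (ha : a ≠ 0) :
    (summandPiecesPrWith X (archPresentationDH X logv hc).toLocalPieces hlog).logvol j (infty X)
        ((archPresentationDH X logv hc).comparison j ⁻¹' archPrincipalRegion X j a) =
      ArchPresentation.logμ (T := thetaIndex X) (infty X) j (archPrincipalRegion X j a) := by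
  rw [SummandPieces.logvol_eq_of_pi (R := fun _ : Unit => _)
    ((archPresentationDH X logv hc).e_image_preimage j _) (fun _ => adm_archPrincipalRegion X j ha)]
  show ∑ _u : Unit, (1 : ℝ) * ArchPresentation.logμ (T := thetaIndex X) (Sum.inl ()) j _ = _
  rw [Fintype.sum_unique, one_mul]

/-- Away from `∞` the merged container and `summandPiecesPr` have the same local pieces, and `idealRegionWith R` is
`idealRegion`: the log-volumes agree. [folklore] -/
theorem logvol_merged_idealRegionWith_of_ne (A : LocalPieces (logShellsDH X logv) (infty X))
    (R : ∀ j' : (thetaIndex X).Label, Set ((logShellsDH X logv).Packet j' (infty X)))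
    (J : HeightOneSpectrum (𝓞 F) →₀ ℤ) {vQ : (thetaIndex X).VQ} (hne : vQ ≠ infty X) :
    (summandPiecesPrWith X A hlog).logvol j vQ (idealRegionWith X R hlog j J vQ) =
      (summandPiecesPr X hlog).logvol j vQ (idealRegion X hlog j J vQ) := by
  rcases vQ with u | pp
  · exact absurd rfl hne
  · rfl

/-- **THE PRODUCT FORMULA INSIDE THE MERGED CONTAINER** (abc-iut-c312-1 `summandPiecesPrWith X (archPresentationDH X logv hc)
.toLocalPieces hlog`, `Thm311RealDegreeArch`: probability weights at the primes ⊕ w5-d163's archimedean pieces): the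
region of the principal Arakelov divisor of `a ∈ F^×` — c312-1's `idealRegionWith` of `−div(a)` with archimedean
component `e⁻¹(ι_j(a)·B_I)` — has total log-volume `Σᶠ_{v_ℚ ∈ 𝕍_ℚ} logvol = 0`, for every label `j`.
[claim: Mochizuki2012, status: disputed] -/
theorem finsum_logvol_merged_principal_eq_zero (ha : a ≠ 0) :
    ∑ᶠ vQ : (thetaIndex X).VQ,
        (summandPiecesPrWith X (archPresentationDH X logv hc).toLocalPieces hlog).logvol j vQ
          (idealRegionWith X
              (fun j' => (archPresentationDH X logv hc).comparison j' ⁻¹' archPrincipalRegion X j' a)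
              hlog j (negDiv a) vQ) = 0 := by
  classical
  set μ := ArchPresentation.logμ (T := thetaIndex X) (infty X) j (archPrincipalRegion X j a) with hμ
  set g : (thetaIndex X).VQ → ℝ := fun vQ =>
    (summandPiecesPr X hlog).logvol j vQ (idealRegion X hlog j (negDiv a) vQ) with hg
  have hdecomp : (fun vQ : (thetaIndex X).VQ =>
      (summandPiecesPrWith X (archPresentationDH X logv hc).toLocalPieces hlog).logvol j vQ
        (idealRegionWith X
          (fun j' => (archPresentationDH X logv hc).comparison j' ⁻¹' archPrincipalRegion X j' a)
          hlog j (negDiv a) vQ)) =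
      fun vQ => g vQ + if vQ = infty X then μ else 0 := by
    funext vQ
    by_cases h : vQ = infty X
    · subst h
      rw [if_pos rfl, hg]
      dsimp only
      rw [logvol_idealRegion_inl X hlog j (negDiv a) (), zero_add, hμ]
      exact logvol_merged_archPrincipalRegion X j hlog hc ha
    · rw [if_neg h, add_zero]
      exact logvol_merged_idealRegionWith_of_ne X j hlog _ _ (negDiv a) h
  have hgfin : (Function.support g).Finite :=
    (Finset.finite_toSet _).subset (support_logvol_idealRegion_subset X hlog j (negDiv a))
  have hιfin : (Function.support fun vQ : (thetaIndex X).VQ => if vQ = infty X then μ else 0).Finite :=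
    (Set.finite_singleton (infty X)).subset fun vQ hv => by
      by_contra h
      exact hv (if_neg h)
  rw [hdecomp, finsum_add_distrib hgfin hιfin,
    finsum_eq_single (fun vQ : (thetaIndex X).VQ => if vQ = infty X then μ else 0) (infty X)
      (fun vQ hne => if_neg hne), if_pos rfl]
  exact finsum_logvol_principal_add_arch_eq_zero X j hlog hc ha

end Summit.ABC.IUTFork.Thm311.Real

end
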